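import Summits.NavierStokesRegularity.NavierStokesRegularity.Theses.SymmetryModuliCount
import Literature.Analysis.FluidPDE.TypeIAncientMild
import Literature.Analysis.FluidPDE.KatoSymmetryCovariance
import Literature.Analysis.FluidPDE.KNSSOseenMildDecayTools
import Summits.NavierStokesRegularity.NavierStokesRegularity.Theorems.SqueezeCycleExtremalElementExistsExtraction
import Summits.NavierStokesRegularity.NavierStokesRegularity.Theorems.SymmetryModuliCountSymmetricLiouvilleScrewIsPeriodic
import Summits.NavierStokesRegularity.NavierStokesRegularity.Theorems.SymmetryModuliCountSymmetricLiouvilleRotationCovariance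
import Summits.NavierStokesRegularity.NavierStokesRegularity.Theorems.SymmetryModuliCountSymmetricLiouvillePeriodicBlowdown
import Summits.NavierStokesRegularity.NavierStokesRegularity.Theorems.SymmetryModuliCountSymmetricLiouvilleSmallAtMinusInfinity
import Summits.NavierStokesRegularity.NavierStokesRegularity.Theorems.SymmetryModuliCountSymmetricLiouvilleSelfSimilarLeaf
import Summits.NavierStokesRegularity.NavierStokesRegularity.Theorems.SymmetryModuliCountSymmetricLiouvilleRssFarField
import HarnessLib

/-!
# Route `SymmetryModuliCount`, crux `SymmetricLiouville` (stmt-NavierStokesRegularity-4053), line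
# `blowdown-kills-pitch`: the periodic leaf, the route items `HelicalEndLiouville` (stmt-14062) and
# `BackwardEndVanishing` (stmt-14064) proved, RSS profiles vanish at infinity, and the crux reduced to its open
# rotated-self-similar core

Summits-side theorem file (kind = proof, no definitions) assembling the landed stubs of the line
`blowdown-kills-pitch` (`Cruxes/SymmetricLiouville/Lines/blowdown-kills-pitch.lean`, lead's reshape; stub files
`Theorems/SymmetryModuliCountSymmetricLiouville{ScrewIsPeriodic,RotationCovariance,PeriodicBlowdown,SmallAtMinusInfinity,
SelfSimilarLeaf,RssFarField}.lean`):

* `classCompactness` — F3, sequential compactness of the Type-I ancient mild class `A_C` (`IsTypeIAncientMild C`) with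
  the limit in the class: the tree's `Theorems.exists_tendsto_of_isTypeIAncientMild_seq`;
* `periodicTypeIAncientLiouville` — every element of `A_C` periodic in one direction vanishes: F3 + rotation
  covariance (`stub_rotationCovariance`) feed the blow-down lever `stub_periodicBlowdownVanishing`
  (`√(−t)‖u(t)‖_∞ → 0` at `−∞`, KNSS Thm 5.1 inside `KNSS2009_typeI_rate_liouville_holds`), and the Kato gap
  `stub_smallAtMinusInfinityLiouville` concludes;
* `periodicLeaf` — the Killing leaf `a ∉ range A` of the crux on the whole past (kinematic bridge
  `stub_screwIsPeriodic`: a translation or a screw of nonzero pitch has a pitch vector);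
* `helicalEndLiouville_proof : HelicalEndLiouville` — the ROUTE ITEM stmt-NavierStokesRegularity-14062 (hypothesis `hH`
  of the route's deciding theorem `closes`) BY NAME, unconditionally (end-to-past reduction by the backward time shift);
* `backwardEndVanishing_proof : BackwardEndVanishing` — the route's support item stmt-14064 (hypothesis `hB` of `closes`)
  BY NAME (forward uniqueness of bounded Oseen-mild solutions, `vanishes_of_vanishes_before`);
* `rssFarFieldVanishing` — profiles of (rotated) self-similar elements of `A_C` vanish at infinity (far-field
  recentring `stub_rssFarFieldVanishing` fed with the periodic Liouville theorem), unconditional;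
* `spiralScalingLiouville_of_rss`, `symmetricLiouville_of_rss`, `rotatedSelfSimilarLiouville_of_core`,
  `symmetricLiouville_of_core` — the crux BY NAME from exactly what remains open/foreign: the rotated-self-similar
  Liouville statement for elements of `A_C` that are small far from the centre (`hCore`, the registered stub
  `stub_rssLiouvilleOfFarField`: the symmetry-free Oseen bootstrap to Pineau–Vicol's class (1.10) + PV Thm 1.4 off
  the window + PV Conj. 1.1 on it) and the route item `AxisymEndLiouville` (stmt-14061, `hAx`); the self-similar
  half `A = 0` is the landed `stub_selfSimilarLeaf` (Tsai 1998 Thm 1, `q = ∞`, in the gauge), the conjugacy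
  bookkeeping (translation to the spiral centre, `ξ ↦ ξ/σ`, split on `a ∈ range A`) is proved here. The crux
  implies `hCore` (`Disproof.symmetricLiouville_implies_rss`), so no line can avoid a hypothesis of that strength.

References: Koch–Nadirashvili–Seregin–Šverák, Acta Math. 203 (2009) = arXiv:0709.3599 (Thm 5.1, Rem 6.1, §4, §6);
Tsai, ARMA 143 (1998) Thm 1; Pineau–Vicol arXiv:2607.09619 (Conj. 1.1, Thm 1.4).
-/


noncomputable section

set_option linter.dupNamespace false

open Set Function Filter
open scoped Topology
open Literature.Analysis.FluidPDE
open Summit.NavierStokesRegularity.NavierStokesRegularity.Theses.SymmetryModuliCount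

namespace Summit.NavierStokesRegularity.NavierStokesRegularity.Theorems.SymmetryModuliCountSymmetricLiouville

/-- Local notation for physical space `ℝ³`. -/
local notation "E3" => EuclideanSpace ℝ (Fin 3)


/-! ## F3 is a theorem of the tree -/

/-- **F3 — sequential compactness of `A_C` with the limit in the class** and slice-wise locally uniform
convergence: the tree's `Theorems.exists_tendsto_of_isTypeIAncientMild_seq` (KNSS 2009 Lemma 6.1 + Prop. 4.1)
with its gradient clauses dropped. [cite: KochNadirashviliSereginSverak2009, Lemma 6.1 and Prop. 4.1 (arXiv:0709.3599 pp. 8, 11)] -/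
theorem classCompactness (C : ℝ) :
    ∀ v : ℕ → ℝ → E3 → E3, (∀ n, IsTypeIAncientMild C (v n)) →
      ∃ (φ : ℕ → ℕ) (w : ℝ → E3 → E3), StrictMono φ ∧ IsTypeIAncientMild C w ∧
        ∀ t < 0, TendstoLocallyUniformly (fun n => v (φ n) t) (w t) atTop := by
  intro v hv
  obtain ⟨φ, hφ, W, hW, -, -, hloc, -⟩ := exists_tendsto_of_isTypeIAncientMild_seq C hv
  exact ⟨φ, W, hφ, hW, hloc⟩

/-! ## Conjugation helpers -/

/-- **`A_C` is invariant under space translations** `u ↦ u(·, · + c)` (same constant): smoothness and the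
divergence condition are translation covariant, the heat flow and the Oseen–Duhamel term commute with
translations (`heatFlow_comp_add_right`, `oseenDuhamel_comp_add_right`), the Type-I bound is uniform in `x`
(KNSS 2009 §1, the symmetries of the problem). [cite: KochNadirashviliSereginSverak2009, §1 p. 3 (arXiv:0709.3599)] -/
theorem isTypeIAncientMild_comp_add_right {C : ℝ} {u : ℝ → E3 → E3} (h : IsTypeIAncientMild C u) (c : E3) :
    IsTypeIAncientMild C (fun t x => u t (x + c)) := by
  refine ⟨?_, fun t ht => (h.isDivFree ht).comp_add_right c, fun s t hst ht x => ?_,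
    fun t ht x => h.norm_le ht (x + c)⟩
  · have e : (uncurry fun t x => u t (x + c)) = uncurry u ∘ fun p : ℝ × E3 => (p.1, p.2 + c) := by
      funext p
      rfl
    rw [e]
    refine h.contDiffOn.comp ((contDiff_fst.prodMk (contDiff_snd.add contDiff_const)).contDiffOn) ?_
    intro p hp
    exact mem_prod.2 ⟨(mem_prod.1 hp).1, mem_univ _⟩
  · show u t (x + c) = heatFlow (fun y => u s (y + c)) (t - s) x -
        oseenDuhamel 1 s (fun τ y => u τ (y + c)) (fun τ y => u τ (y + c)) t x
    rw [heatFlow_comp_add_right, oseenDuhamel_comp_add_right]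
    exact h.mild_eq hst ht (x + c)

/-- For `σ ≠ 0` and `A` skew, `σ + A` is invertible (`⟪(σ + A)v, v⟫ = σ‖v‖²`), so the spiral scaling
`ξ = (a, σ, A)` has a CENTRE `c`: `σc + Ac = −a`. [folklore] -/
theorem exists_spiral_centre {σ : ℝ} (hσ : σ ≠ 0) {A : E3 →L[ℝ] E3} (hA : ∀ x, inner ℝ (A x) x = 0)
    (a : E3) : ∃ c : E3, σ • c + A c = -a := by
  let M : E3 →ₗ[ℝ] E3 := σ • LinearMap.id + (A : E3 →ₗ[ℝ] E3)
  have hM : ∀ v, M v = σ • v + A v := fun v => rfl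
  have hinj : Function.Injective M := by
    intro v w hvw
    have h0 : M (v - w) = 0 := by rw [map_sub, hvw, sub_self]
    rw [hM] at h0
    have h1 : inner ℝ (σ • (v - w) + A (v - w)) (v - w) = 0 := by rw [h0, inner_zero_left]
    rw [inner_add_left, hA (v - w), add_zero, real_inner_smul_left, real_inner_self_eq_norm_sq] at h1
    have h2 : ‖v - w‖ ^ 2 = 0 := by
      rcases mul_eq_zero.1 h1 with h | h
      · exact absurd h hσ
      · exact h
    have h3 : v - w = 0 := by
      rw [← norm_eq_zero]
      exact pow_eq_zero_iff two_ne_zero |>.1 h2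
    exact sub_eq_zero.1 h3
  obtain ⟨c, hc⟩ := (LinearMap.injective_iff_surjective.1 hinj) (-a)
  exact ⟨c, by rw [← hM]; exact hc⟩

/-! ## The periodic leaf and the route item `HelicalEndLiouville` -/

/-- **Periodic Type-I ancient Liouville** ("discrete translations are free"): an element of `A_C` which is
periodic in some direction `e ≠ 0` vanishes identically on `t < 0` — F3 + rotation covariance ⇒ blow-down
lever ⇒ Kato gap. [cite: KochNadirashviliSereginSverak2009, proof of Thm 6.2 (arXiv:0709.3599 p. 13)] -/
theorem periodicTypeIAncientLiouville (C : ℝ) (u : ℝ → E3 → E3) (hu : IsTypeIAncientMild C u)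
    (e : E3) (he : e ≠ 0) (hper : ∀ t < 0, ∀ x, u t (x + e) = u t x) : ∀ t < 0, ∀ x, u t x = 0 :=
  stub_smallAtMinusInfinityLiouville C u hu
    (stub_periodicBlowdownVanishing C (classCompactness C) (stub_rotationCovariance C) u hu e he hper)

/-- **The periodic (Killing, `a ∉ range A`) leaf of the crux on the whole past**: an element of `A_C`
annihilated by a Killing generator `(a + Ax)·∇ − A` with `A` skew and `a ∉ range A` — a translation or a
screw motion of nonzero pitch — vanishes (kinematic bridge `stub_screwIsPeriodic` + the periodic Liouville
theorem). Contains the disprover's barrier statement `Disproof.HelicalTypeILiouville`. [cite: KochNadirashviliSereginSverak2009, proof of Thm 6.2 (arXiv:0709.3599 p. 13)] -/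
theorem periodicLeaf (C : ℝ) (u : ℝ → E3 → E3) (hu : IsTypeIAncientMild C u)
    (a : E3) (A : E3 →L[ℝ] E3) (hA : ∀ x, inner ℝ (A x) x = 0) (hra : a ∉ Set.range A)
    (hK : ∀ t < 0, ∀ x, fderiv ℝ (u t) x (a + A x) - A (u t x) = 0) : ∀ t < 0, ∀ x, u t x = 0 := by
  obtain ⟨e, he, hper⟩ := stub_screwIsPeriodic a A hA hra
  have hperu : ∀ t < 0, ∀ x, u t (x + e) = u t x := by
    intro t ht x
    refine hper (u t) ((hu.contDiff_slice ht).differentiable (by simp)) (fun y => ?_) x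
    exact sub_eq_zero.1 (hK t ht y)
  exact periodicTypeIAncientLiouville C u hu e he hperu

/-- **The route item `HelicalEndLiouville` (stmt-NavierStokesRegularity-14062, crux r7 of route
`SymmetryModuliCount`, hypothesis `hH` of its deciding theorem `closes`), proved BY NAME**: the helical /
translational leaf on a backward END `t < θ`, `θ ≤ 0`, reduced to the whole past by the backward time shift
`u(· + θ) ∈ A_C` (`IsTypeIAncientMild.comp_sub_right`; the Killing symmetry is time independent). [cite: KochNadirashviliSereginSverak2009, proof of Thm 6.2 (arXiv:0709.3599 p. 13)] -/
theorem helicalEndLiouville_proof : HelicalEndLiouville := by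
  intro C u hcl a A θ hA hra hθ hsym t ht x
  have hv : IsTypeIAncientMild C (fun s => u (s - -θ)) := hcl.comp_sub_right (by linarith)
  have hsv : ∀ s < 0, ∀ y,
      fderiv ℝ ((fun s => u (s - -θ)) s) y (a + A y) - A ((fun s => u (s - -θ)) s y) = 0 := by
    intro s hs y
    exact hsym (s - -θ) (by linarith) y
  have key := periodicLeaf C (fun s => u (s - -θ)) hv a A hA hra hsv (t - θ) (by linarith) x
  have e : t - θ - -θ = t := by ring
  simpa only [e] using key

/-- **The route's support item `BackwardEndVanishing` (stmt-NavierStokesRegularity-14064, hypothesis `hB` of the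
deciding theorem `closes`) BY NAME**: vanishing on a backward end `t < θ`, `θ ≤ 0`, propagates to all of `t < 0`
— forward uniqueness of bounded Oseen-mild solutions (`oseenMild_bounded_unique`, KNSS 2009 §4), as packaged in
the landed helper `vanishes_of_vanishes_before` of the stub file `…SmallAtMinusInfinity`; the case `θ = 0` is
tautological. [cite: KochNadirashviliSereginSverak2009, §4 (4.3)–(4.4) (arXiv:0709.3599 p. 8)] -/
theorem backwardEndVanishing_proof : BackwardEndVanishing := by
  intro C u hcl θ hθ hz
  rcases lt_or_eq_of_le hθ with hθ0 | rfl
  · exact vanishes_of_vanishes_before hcl hθ0 hz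
  · exact hz

/-! ## The spiral leaf: profiles vanish at infinity; the narrowed open core -/

/-- **Profiles of (rotated) self-similar elements of `A_C` vanish at infinity** (unconditional): if `u ∈ A_C` is
annihilated by the spiral-scaling generator about the space–time origin, `∇u·(x + Ax) + u + 2t∂ₜu − Au = 0`
with `A` skew (any rate, `A = 0` allowed), then `√(−t)‖u(t, x)‖ ≤ ε` whenever `‖x‖ ≥ R(ε)√(−t)` — in profile
terms `u(t, x) = (−t)^{-1/2}e^{…}U(·/√(−t))`, the bounded profile `U` tends to `0` at infinity. Far-field
recentring (`stub_rssFarFieldVanishing`) fed with the periodic Liouville theorem of this file. This is step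
"B1" of the crux cards for the spiral leaf and narrows the open core of the crux to profiles vanishing at
infinity (Pineau–Vicol's class (1.10) asks for the rate `1/|y|`). [cite: KochNadirashviliSereginSverak2009, proof of Thm 6.2 (arXiv:0709.3599 p. 13)] -/
theorem rssFarFieldVanishing (C : ℝ) (u : ℝ → E3 → E3) (hu : IsTypeIAncientMild C u)
    (A : E3 →L[ℝ] E3) (hA : ∀ x, inner ℝ (A x) x = 0)
    (hL : ∀ t < 0, ∀ x, fderiv ℝ (u t) x (x + A x) + u t x + (2 * t) • timeDeriv u t x - A (u t x) = 0) :
    ∀ ε > 0, ∃ R : ℝ, ∀ t < 0, ∀ x, R * Real.sqrt (-t) ≤ ‖x‖ → Real.sqrt (-t) * ‖u t x‖ ≤ ε :=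
  stub_rssFarFieldVanishing C (periodicTypeIAncientLiouville C) u hu A hA hL

/-- **The bounded-profile rotated-self-similar Liouville statement from the NARROWED open core**: given the
Liouville theorem for rotated-self-similar elements of `A_C` whose scale-invariant size is small far from the
centre (`hCore`, the registered stub `stub_rssLiouvilleOfFarField` — still open: Oseen bootstrap to
Pineau–Vicol's class + PV Conj. 1.1 window), every bounded-profile RSS element of `A_C` vanishes, by
`rssFarFieldVanishing`. [cite: PineauVicol2026, Conjecture 1.1 and Theorem 1.4 (arXiv:2607.09619 p. 4)] -/
theorem rotatedSelfSimilarLiouville_of_core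
    (hCore : ∀ (C : ℝ) (u : ℝ → E3 → E3), IsTypeIAncientMild C u →
      ∀ A : E3 →L[ℝ] E3, (∀ x, inner ℝ (A x) x = 0) → A ≠ 0 →
        (∀ t < 0, ∀ x, fderiv ℝ (u t) x (x + A x) + u t x + (2 * t) • timeDeriv u t x - A (u t x) = 0) →
        (∀ ε > 0, ∃ R : ℝ, ∀ t < 0, ∀ x, R * Real.sqrt (-t) ≤ ‖x‖ → Real.sqrt (-t) * ‖u t x‖ ≤ ε) →
        ∀ t < 0, ∀ x, u t x = 0) :
    ∀ (C : ℝ) (u : ℝ → E3 → E3), IsTypeIAncientMild C u →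
      ∀ A : E3 →L[ℝ] E3, (∀ x, inner ℝ (A x) x = 0) → A ≠ 0 →
        (∀ t < 0, ∀ x, fderiv ℝ (u t) x (x + A x) + u t x + (2 * t) • timeDeriv u t x - A (u t x) = 0) →
        ∀ t < 0, ∀ x, u t x = 0 :=
  fun C u hu A hA hA0 hL => hCore C u hu A hA hA0 hL (rssFarFieldVanishing C u hu A hA hL)

/-! ## The crux modulo its open rotated-self-similar core -/

/-- **The spiral-scaling leaf in normal form from its two halves**: `A = 0` is the landed self-similar leaf
(Tsai 1998 Thm 1, `q = ∞`, in the gauge: `stub_selfSimilarLeaf`); `A ≠ 0` is the bounded-profile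
rotated-self-similar Liouville statement `hRSS` (= `Disproof.RotatedSelfSimilarLiouville`; OPEN: Pineau–Vicol
Conj. 1.1 window), taken as a hypothesis. [cite: Tsai1998, Thm 1 (p. 31)] -/
theorem spiralScalingLiouville_of_rss
    (hRSS : ∀ (C : ℝ) (u : ℝ → E3 → E3), IsTypeIAncientMild C u →
      ∀ A : E3 →L[ℝ] E3, (∀ x, inner ℝ (A x) x = 0) → A ≠ 0 →
        (∀ t < 0, ∀ x, fderiv ℝ (u t) x (x + A x) + u t x + (2 * t) • timeDeriv u t x - A (u t x) = 0) →
        ∀ t < 0, ∀ x, u t x = 0)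
    (C : ℝ) (u : ℝ → E3 → E3) (hcl : IsTypeIAncientMild C u)
    (A : E3 →L[ℝ] E3) (hA : ∀ x, inner ℝ (A x) x = 0)
    (hL : ∀ t < 0, ∀ x, fderiv ℝ (u t) x (x + A x) + u t x + (2 * t) • timeDeriv u t x - A (u t x) = 0) :
    ∀ t < 0, ∀ x, u t x = 0 := by
  rcases eq_or_ne A 0 with rfl | hA0
  · refine stub_selfSimilarLeaf C u hcl ?_
    intro t ht x
    simpa only [zero_apply, add_zero, sub_zero] using hL t ht x
  · exact hRSS C u hcl A hA hA0 hL

/-- **The crux `SymmetricLiouville` (stmt-NavierStokesRegularity-4053) BY NAME, modulo exactly its open core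
and the sibling route item**: given the bounded-profile rotated-self-similar Liouville statement `hRSS`
(`Disproof.RotatedSelfSimilarLiouville`; the registered stub `stub_rotatedSelfSimilarLiouville`, blocked on the
named fact `pineauVicol2026_rss_liouville` / Pineau–Vicol Conj. 1.1) and the route item `AxisymEndLiouville`
(stmt-14061, `hAx`), every element of `A_C` with a nonzero infinitesimal similarity symmetry vanishes.
Conjugacy bookkeeping: `σ = 0` ⇒ split on `a ∈ range A` (rotation about the axis through `−c`: `hAx` at
`θ = 0`) / `a ∉ range A` (`periodicLeaf`, unconditional); `σ ≠ 0` ⇒ translate to the spiral centre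
(`exists_spiral_centre`, `isTypeIAncientMild_comp_add_right`), divide the generator by `σ`,
`spiralScalingLiouville_of_rss`. The crux implies `hRSS` (`Disproof.symmetricLiouville_implies_rss`), so the
hypothesis is not avoidable by any line. [cite: KochNadirashviliSereginSverak2009, §1 p. 3 (arXiv:0709.3599)] -/
theorem symmetricLiouville_of_rss
    (hRSS : ∀ (C : ℝ) (u : ℝ → E3 → E3), IsTypeIAncientMild C u →
      ∀ A : E3 →L[ℝ] E3, (∀ x, inner ℝ (A x) x = 0) → A ≠ 0 →
        (∀ t < 0, ∀ x, fderiv ℝ (u t) x (x + A x) + u t x + (2 * t) • timeDeriv u t x - A (u t x) = 0) →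
        ∀ t < 0, ∀ x, u t x = 0)
    (hAx : AxisymEndLiouville) : SymmetricLiouville := by
  intro C u hu a σ A hA hne hL t ht x
  have hcl : IsTypeIAncientMild C u := isTypeIAncientMild_iff.2 hu
  rcases eq_or_ne σ 0 with rfl | hσ
  · -- ISOMETRIC (Killing) leaves: `L_ξ u = ∇u·(a + Ax) − Au`
    have hK : ∀ t < 0, ∀ x, fderiv ℝ (u t) x (a + A x) - A (u t x) = 0 := by
      intro t ht x
      have h1' := hL t ht x
      simp only [zero_smul, add_zero, mul_zero, zero_mul] at h1'
      exact h1'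
    by_cases hra : a ∈ Set.range A
    · -- rotation about the axis through `-c`: route item `AxisymEndLiouville` at `θ = 0`
      obtain ⟨c, hc⟩ := hra
      have hA0 : A ≠ 0 := by
        rintro rfl
        apply hne
        refine ⟨?_, rfl, rfl⟩
        rw [← hc, zero_apply]
      refine hAx C u hcl (-c) A 0 hA hA0 le_rfl ?_ t ht x
      intro t ht x
      have e : A (x - -c) = a + A x := by
        rw [sub_neg_eq_add, map_add, hc, add_comm]
      rw [e]
      exact hK t ht x
    · -- translation or screw of nonzero pitch: the periodic leaf (unconditional)
      exact periodicLeaf C u hcl a A hA hra hK t ht x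
  · -- SPIRAL SCALINGS `σ ≠ 0`: translate to the centre, normalise the rate to `1`
    obtain ⟨c, hc⟩ := exists_spiral_centre hσ hA a
    have hv : IsTypeIAncientMild C (fun t x => u t (x + c)) := isTypeIAncientMild_comp_add_right hcl c
    obtain ⟨A', hA'def⟩ : ∃ A' : E3 →L[ℝ] E3, A' = σ⁻¹ • A := ⟨_, rfl⟩
    have hA' : ∀ x, inner ℝ (A' x) x = 0 := by
      intro x
      rw [hA'def, smul_apply, real_inner_smul_left, hA x, mul_zero]
    -- the normalised symmetry of the translated field
    have hLv : ∀ t < 0, ∀ x, fderiv ℝ (fun y => u t (y + c)) x (x + A' x) + u t (x + c) +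
        (2 * t) • timeDeriv (fun s y => u s (y + c)) t x - A' (u t (x + c)) = 0 := by
      intro t ht x
      have key := hL t ht (x + c)
      have e1 : a + σ • (x + c) + A (x + c) = σ • x + A x := by
        have h0 : σ • c + A c + a = 0 := by rw [hc, neg_add_cancel]
        calc a + σ • (x + c) + A (x + c) = σ • x + A x + (σ • c + A c + a) := by
              rw [smul_add, map_add]; abel
          _ = σ • x + A x := by rw [h0, add_zero]
      rw [e1] at key
      have e2 : fderiv ℝ (fun y => u t (y + c)) x = fderiv ℝ (u t) (x + c) := by
        rw [fderiv_comp_add_right]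
      have e3 : timeDeriv (fun s y => u s (y + c)) t x = timeDeriv u t (x + c) := rfl
      rw [e2, e3]
      have k2 := congrArg (fun w => σ⁻¹ • w) key
      simp only [smul_zero, smul_add, smul_sub, smul_smul, inv_mul_cancel₀ hσ, one_smul] at k2
      have e5 : σ⁻¹ * (2 * σ * t) = 2 * t := by
        rw [mul_comm 2 σ, mul_assoc, inv_mul_cancel_left₀ hσ]
      have e6 : σ⁻¹ • fderiv ℝ (u t) (x + c) (σ • x + A x) = fderiv ℝ (u t) (x + c) (x + A' x) := by
        rw [← (fderiv ℝ (u t) (x + c)).map_smul]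
        congr 1
        rw [hA'def, smul_apply, smul_add, smul_smul, inv_mul_cancel₀ hσ, one_smul]
      have e7 : σ⁻¹ • A (u t (x + c)) = A' (u t (x + c)) := by
        rw [hA'def, smul_apply]
      rw [e5, e6, e7] at k2
      exact k2
    -- conclude on the translated field, then translate back
    have hzero : ∀ t < 0, ∀ x, (fun t x => u t (x + c)) t x = 0 :=
      spiralScalingLiouville_of_rss hRSS C (fun t x => u t (x + c)) hv A' hA' hLv
    have := hzero t ht (x - c)
    simpa only [sub_add_cancel] using this

/-- **The crux `SymmetricLiouville` BY NAME from the NARROWED open core and the sibling route item**: the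
line `blowdown-kills-pitch` reduces stmt-NavierStokesRegularity-4053 to (i) `hCore` = the registered stub
`stub_rssLiouvilleOfFarField` (rotated-self-similar elements of `A_C`, `A ≠ 0`, small far from the centre,
vanish — the Pineau–Vicol window problem after the Oseen bootstrap) and (ii) the route item `AxisymEndLiouville`
(stmt-14061). Everything else (translation / helical leaves, the self-similar leaf, far-field vanishing of RSS
profiles, the conjugacy bookkeeping) is proved. [cite: PineauVicol2026, Conjecture 1.1 (arXiv:2607.09619 p. 4)] -/
theorem symmetricLiouville_of_core
    (hCore : ∀ (C : ℝ) (u : ℝ → E3 → E3), IsTypeIAncientMild C u →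
      ∀ A : E3 →L[ℝ] E3, (∀ x, inner ℝ (A x) x = 0) → A ≠ 0 →
        (∀ t < 0, ∀ x, fderiv ℝ (u t) x (x + A x) + u t x + (2 * t) • timeDeriv u t x - A (u t x) = 0) →
        (∀ ε > 0, ∃ R : ℝ, ∀ t < 0, ∀ x, R * Real.sqrt (-t) ≤ ‖x‖ → Real.sqrt (-t) * ‖u t x‖ ≤ ε) →
        ∀ t < 0, ∀ x, u t x = 0)
    (hAx : AxisymEndLiouville) : SymmetricLiouville :=
  symmetricLiouville_of_rss (rotatedSelfSimilarLiouville_of_core hCore) hAx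

end Summit.NavierStokesRegularity.NavierStokesRegularity.Theorems.SymmetryModuliCountSymmetricLiouville

end
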